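import Mathlib
import Summits.ValiantsHypothesis.ValiantsHypothesis.Theorems.RigidityForcesSymmetryRankRigidMinimalReprLaplaceFiveSeparatedCaptureDefs

/-!
# ValiantsHypothesis / RigidityForcesSymmetry — crux `LaplaceOptimalFive` (stmt-ValiantsHypothesis-24813), young-shadow K1:
# **THE PROLONGATION BOUND** `dim prolong X ≤ 1, 2, 4` for `dim X ≤ 1, 2, 3` (lemma toward CASE II of the profile `(1,1,2)` of (SC))

For a space `X` of symmetric `5 × 5` matrices, the PROLONGATION `prolong X` is the space of fully symmetric 3-tensors
`G : Fin 5 → Fin 5 → Fin 5 → ℂ` all of whose slices `G p` lie in `X` («cubics all of whose partials lie in `X`»).  We prove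
`dim prolong X ≤ 1` if `dim X ≤ 1`, `≤ 2` if `dim X ≤ 2`, and `≤ 4` if `dim X ≤ 3` (sharp: `X = Sym² P` for a `2`-plane `P` gives
`prolong X = Sym³ P`, dimension `4`).  This is the first instance of Macaulay's growth bound for inverse systems
(`h₃ ≤ h₂^⟨2⟩`; F. S. Macaulay 1927, cf. Bruns–Herzog, *Cohen–Macaulay rings*, Thm. 4.2.10) — cited as CONTEXT only: the proof here
is the elementary slice argument of the critic of record (val-idea-crit-3 g8, bus 09:18:52Z), coordinate-wise and induction-free
beyond the three dimensions needed:

* fix a letter `p`; the SLICE map `G ↦ G p` on `prolong X` has kernel inside `prolong (K_p)`, `K_p = {x ∈ X : x p = 0}` (a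
  `p`-killed fully symmetric `G` has `p`-row-free slices, by the `(1 2)` symmetry), and image inside `X` whose members have ALL ROWS in
  `L_p = {x p : x ∈ X}` (row `q` of `G p` is row `p` of `G q`);
* a symmetric matrix with all rows on a line `ℂ λ` is a multiple of `λ λᵀ`, so the image has dimension `≤ 1` when `dim L_p ≤ 1`;
* rank–nullity for the row map (`dim K_p + dim L_p = dim X`) and for the slice map, with `p` chosen so that `L_p ≠ 0`.

Declarations: `prolong` (the one definition), `sliceMap`, `rowMap` (abbreviations of `LinearMap.proj`), the containments
`ker_slice_le`, `range_slice_le`, `range_slice_le_line`, the dimension identities, and ★ `finrank_prolong_le_one`,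
★ `finrank_prolong_le_two`, ★★ `finrank_prolong_le_four`.

Honest framing.  A LEMMA (linear algebra of symmetric tensors) commissioned for CASE II of the OPEN profile `(1,1,2)` of `CaptureIneqSym`;
it closes nothing by itself.  K1 on `K₃ ⊔ K₂`, `CaptureIneqSym`, S2′, `LaplaceOptimalFive` (OPEN · CONTESTED 72/120),
`RankRigidMinimalRepr`, `VP ≠ VNP` are NOT proved.  One definition (`prolong`), no `sorry`.
-/

set_option linter.dupNamespace false
set_option autoImplicit false

namespace Summit.ValiantsHypothesis.ValiantsHypothesis.Theorems.RigidityForcesSymmetryRankRigidMinimalRepr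

namespace LaplaceFiveSeparatedCapture

open Finset

/-- **PROLONGATION of a space of matrices**: the fully symmetric 3-tensors all of whose slices lie in `X`
(`G (p q r) = G (q p r) = G (p r q)` and `G p ∈ X` for every letter `p`). [folklore] -/
def prolong (X : Submodule ℂ (Fin 5 → Fin 5 → ℂ)) : Submodule ℂ (Fin 5 → Fin 5 → Fin 5 → ℂ) where
  carrier := {G | (∀ p q r : Fin 5, G p q r = G q p r) ∧ (∀ p q r : Fin 5, G p q r = G p r q) ∧ ∀ p : Fin 5, G p ∈ X}
  add_mem' := by
    rintro G H ⟨hG1, hG2, hG3⟩ ⟨hH1, hH2, hH3⟩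
    refine ⟨fun p q r => ?_, fun p q r => ?_, fun p => ?_⟩
    · simp only [Pi.add_apply, hG1 p q r, hH1 p q r]
    · simp only [Pi.add_apply, hG2 p q r, hH2 p q r]
    · exact X.add_mem (hG3 p) (hH3 p)
  zero_mem' := ⟨fun _ _ _ => rfl, fun _ _ _ => rfl, fun _ => X.zero_mem⟩
  smul_mem' := by
    rintro c G ⟨hG1, hG2, hG3⟩
    refine ⟨fun p q r => ?_, fun p q r => ?_, fun p => ?_⟩
    · simp only [Pi.smul_apply, hG1 p q r]
    · simp only [Pi.smul_apply, hG2 p q r]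
    · exact X.smul_mem c (hG3 p)

/-- Membership in the prolongation, unfolded. [folklore] -/
theorem mem_prolong_iff (X : Submodule ℂ (Fin 5 → Fin 5 → ℂ)) (G : Fin 5 → Fin 5 → Fin 5 → ℂ) :
    G ∈ prolong X ↔ (∀ p q r : Fin 5, G p q r = G q p r) ∧ (∀ p q r : Fin 5, G p q r = G p r q) ∧ ∀ p : Fin 5, G p ∈ X :=
  Iff.rfl

/-- The prolongation is monotone. [folklore] -/
theorem prolong_mono {X Y : Submodule ℂ (Fin 5 → Fin 5 → ℂ)} (h : X ≤ Y) : prolong X ≤ prolong Y := by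
  rintro G ⟨h1, h2, h3⟩
  exact ⟨h1, h2, fun p => h (h3 p)⟩

/-- The prolongation of the zero space is zero (a tensor with all slices zero is zero). [folklore] -/
theorem prolong_bot : prolong (⊥ : Submodule ℂ (Fin 5 → Fin 5 → ℂ)) = ⊥ := by
  refine le_bot_iff.mp ?_
  rintro G ⟨-, -, h3⟩
  rw [Submodule.mem_bot]
  funext p
  exact (Submodule.mem_bot ℂ).mp (h3 p)

/-- The SLICE map at a letter `p`: `G ↦ G p`. [folklore] -/
abbrev sliceMap (p : Fin 5) : (Fin 5 → Fin 5 → Fin 5 → ℂ) →ₗ[ℂ] (Fin 5 → Fin 5 → ℂ) := LinearMap.proj p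

/-- The ROW map at a letter `p`: `x ↦ x p`. [folklore] -/
abbrev rowMap (p : Fin 5) : (Fin 5 → Fin 5 → ℂ) →ₗ[ℂ] (Fin 5 → ℂ) := LinearMap.proj p

/-- The `p`-killed part of `X`: `K_p = {x ∈ X : x p = 0}` (as a space of matrices). [folklore] -/
abbrev rowKer (X : Submodule ℂ (Fin 5 → Fin 5 → ℂ)) (p : Fin 5) : Submodule ℂ (Fin 5 → Fin 5 → ℂ) :=
  (LinearMap.ker ((rowMap p).domRestrict X)).map X.subtype

/-- The `p`-th rows of `X`: `L_p = {x p : x ∈ X}`. [folklore] -/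
abbrev rowIm (X : Submodule ℂ (Fin 5 → Fin 5 → ℂ)) (p : Fin 5) : Submodule ℂ (Fin 5 → ℂ) := X.map (rowMap p)

/-- Members of `K_p` lie in `X` and have zero `p`-th row. [folklore] -/
theorem mem_rowKer_iff (X : Submodule ℂ (Fin 5 → Fin 5 → ℂ)) (p : Fin 5) (x : Fin 5 → Fin 5 → ℂ) :
    x ∈ rowKer X p ↔ x ∈ X ∧ x p = 0 := by
  constructor
  · rintro ⟨y, hy, rfl⟩
    exact ⟨y.2, by simpa using hy⟩
  · rintro ⟨hx, hp⟩
    exact ⟨⟨x, hx⟩, by simpa using hp, rfl⟩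

/-- `K_p ≤ X`. [folklore] -/
theorem rowKer_le (X : Submodule ℂ (Fin 5 → Fin 5 → ℂ)) (p : Fin 5) : rowKer X p ≤ X :=
  fun x hx => ((mem_rowKer_iff X p x).mp hx).1

/-- **Rank–nullity for the row map**: `dim K_p + dim L_p = dim X`. [folklore] -/
theorem finrank_rowKer_add_finrank_rowIm (X : Submodule ℂ (Fin 5 → Fin 5 → ℂ)) (p : Fin 5) :
    Module.finrank ℂ (rowKer X p) + Module.finrank ℂ (rowIm X p) = Module.finrank ℂ X := by
  have h := LinearMap.finrank_range_add_finrank_ker ((rowMap p).domRestrict X)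
  have hrange : LinearMap.range ((rowMap p).domRestrict X) = rowIm X p := by
    ext y
    simp only [LinearMap.mem_range, Submodule.mem_map]
    constructor
    · rintro ⟨x, rfl⟩
      exact ⟨x, x.2, rfl⟩
    · rintro ⟨x, hx, rfl⟩
      exact ⟨⟨x, hx⟩, rfl⟩
  rw [hrange] at h
  rw [Submodule.finrank_map_subtype_eq]
  omega

/-- **Kernel of the slice map**: a fully symmetric `G` with slices in `X` and `G p = 0` has all its slices in `K_p`
(row `p` of the slice `G q` is row `q` of the slice `G p`). [folklore] -/
theorem ker_slice_le (X : Submodule ℂ (Fin 5 → Fin 5 → ℂ)) (p : Fin 5) :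
    (LinearMap.ker ((sliceMap p).domRestrict (prolong X))).map (prolong X).subtype ≤ prolong (rowKer X p) := by
  rintro G ⟨G', hG', rfl⟩
  obtain ⟨h1, h2, h3⟩ := G'.2
  have hp : (G' : Fin 5 → Fin 5 → Fin 5 → ℂ) p = 0 := by simpa using hG'
  refine ⟨h1, h2, fun q => (mem_rowKer_iff X p _).mpr ⟨h3 q, ?_⟩⟩
  funext r
  have := congr_fun (congr_fun hp q) r
  -- `G q p r = G p q r = 0`
  rw [Pi.zero_apply, Pi.zero_apply] at this
  show (G' : Fin 5 → Fin 5 → Fin 5 → ℂ) q p r = 0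
  rw [← h1 p q r, this]

/-- **Image of the slice map**: inside `X`. [folklore] -/
theorem range_slice_le (X : Submodule ℂ (Fin 5 → Fin 5 → ℂ)) (p : Fin 5) :
    LinearMap.range ((sliceMap p).domRestrict (prolong X)) ≤ X := by
  rintro M ⟨G, rfl⟩
  exact G.2.2.2 p

/-- A symmetric matrix all of whose rows lie on the line `ℂ λ` is a multiple of `λ λᵀ`. [folklore] -/
theorem mem_span_outer_of_rows (M : Fin 5 → Fin 5 → ℂ) (hM : ∀ q r : Fin 5, M q r = M r q) (lam : Fin 5 → ℂ)
    (hrows : ∀ q : Fin 5, ∃ c : ℂ, M q = c • lam) : M ∈ (ℂ ∙ (fun q r => lam q * lam r) : Submodule ℂ (Fin 5 → Fin 5 → ℂ)) := by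
  classical
  rw [Submodule.mem_span_singleton]
  by_cases hlam : lam = 0
  · -- all rows are zero
    refine ⟨0, ?_⟩
    funext q r
    obtain ⟨c, hc⟩ := hrows q
    simp [hc, hlam]
  · obtain ⟨r₀, hr₀⟩ := Function.ne_iff.mp hlam
    have hr₀' : lam r₀ ≠ 0 := by simpa using hr₀
    choose c hc using hrows
    -- symmetry at (q, r₀): c_q λ_{r₀} = c_{r₀} λ_q
    refine ⟨c r₀ / lam r₀, ?_⟩
    funext q r
    have hsym := hM q r₀
    rw [hc q, hc r₀] at hsym
    simp only [Pi.smul_apply, smul_eq_mul] at hsym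
    have hcq : c q = c r₀ * lam q / lam r₀ := by
      rw [eq_div_iff hr₀']
      linear_combination hsym
    have hqr := congr_fun (hc q) r
    simp only [Pi.smul_apply, smul_eq_mul] at hqr
    simp only [Pi.smul_apply, smul_eq_mul]
    rw [hqr, hcq]
    field_simp

/-- **Image of the slice map when the `p`-th rows of `X` span at most a line**: dimension `≤ 1`. [folklore] -/
theorem finrank_range_slice_le_one (X : Submodule ℂ (Fin 5 → Fin 5 → ℂ))
    (hXs : ∀ x ∈ X, ∀ q r : Fin 5, x q r = x r q) (p : Fin 5) (hL : Module.finrank ℂ (rowIm X p) ≤ 1) :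
    Module.finrank ℂ (LinearMap.range ((sliceMap p).domRestrict (prolong X))) ≤ 1 := by
  classical
  -- `L_p` is `⊥` or a line `ℂ λ`
  obtain ⟨lam, hLle⟩ : ∃ lam : Fin 5 → ℂ, rowIm X p ≤ ℂ ∙ lam := by
    rcases Nat.lt_or_ge (Module.finrank ℂ (rowIm X p)) 1 with h0 | h1
    · refine ⟨0, ?_⟩
      have hb : rowIm X p = ⊥ := Submodule.finrank_eq_zero.mp (by omega)
      rw [hb]
      exact bot_le
    · obtain ⟨v, hv, hgen⟩ := finrank_eq_one_iff'.mp (le_antisymm hL h1)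
      refine ⟨(v : Fin 5 → ℂ), fun y hy => ?_⟩
      obtain ⟨c, hc⟩ := hgen ⟨y, hy⟩
      rw [Submodule.mem_span_singleton]
      exact ⟨c, by simpa using congrArg Subtype.val hc⟩
  -- every member of the image is a multiple of `λ λᵀ`
  have hle : LinearMap.range ((sliceMap p).domRestrict (prolong X))
      ≤ (ℂ ∙ (fun q r => lam q * lam r) : Submodule ℂ (Fin 5 → Fin 5 → ℂ)) := by
    rintro M ⟨G, rfl⟩
    obtain ⟨h1, -, h3⟩ := G.2
    refine mem_span_outer_of_rows _ (fun q r => hXs _ (h3 p) q r) lam fun q => ?_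
    -- row `q` of `G p` is row `p` of `G q ∈ X`, hence in `L_p ≤ ℂ λ`
    have hrow : (fun r => (G : Fin 5 → Fin 5 → Fin 5 → ℂ) q p r) ∈ rowIm X p :=
      ⟨(G : Fin 5 → Fin 5 → Fin 5 → ℂ) q, h3 q, rfl⟩
    obtain ⟨c, hc⟩ := Submodule.mem_span_singleton.mp (hLle hrow)
    refine ⟨c, ?_⟩
    funext r
    have := congr_fun hc r
    simp only [Pi.smul_apply, smul_eq_mul] at this ⊢
    show (G : Fin 5 → Fin 5 → Fin 5 → ℂ) p q r = c * lam r
    rw [h1 p q r, ← this]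
  refine (Submodule.finrank_mono hle).trans ?_
  by_cases h0 : (fun q r => lam q * lam r : Fin 5 → Fin 5 → ℂ) = 0
  · rw [h0, Submodule.span_zero_singleton, finrank_bot]
    exact zero_le_one
  · exact (finrank_span_singleton h0).le

/-- **The slice step**: `dim prolong X ≤ dim prolong K_p + dim (image of the slice map at p)`. [folklore] -/
theorem finrank_prolong_le_step (X : Submodule ℂ (Fin 5 → Fin 5 → ℂ)) (p : Fin 5) :
    Module.finrank ℂ (prolong X) ≤ Module.finrank ℂ (prolong (rowKer X p))
      + Module.finrank ℂ (LinearMap.range ((sliceMap p).domRestrict (prolong X))) := by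
  have h := LinearMap.finrank_range_add_finrank_ker ((sliceMap p).domRestrict (prolong X))
  have hker : Module.finrank ℂ (LinearMap.ker ((sliceMap p).domRestrict (prolong X)))
      ≤ Module.finrank ℂ (prolong (rowKer X p)) := by
    rw [← Submodule.finrank_map_subtype_eq (prolong X) (LinearMap.ker ((sliceMap p).domRestrict (prolong X)))]
    exact Submodule.finrank_mono (ker_slice_le X p)
  omega

/-- A nonzero space of matrices has a letter `p` with a nonzero `p`-th row space. [folklore] -/
theorem exists_finrank_rowIm_pos (X : Submodule ℂ (Fin 5 → Fin 5 → ℂ)) (hX : X ≠ ⊥) :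
    ∃ p : Fin 5, 0 < Module.finrank ℂ (rowIm X p) := by
  obtain ⟨x, hx, hx0⟩ := (Submodule.ne_bot_iff X).mp hX
  obtain ⟨p, hp⟩ := Function.ne_iff.mp hx0
  refine ⟨p, Module.finrank_pos_iff_exists_ne_zero.mpr ⟨⟨x p, ⟨x, hx, rfl⟩⟩, ?_⟩⟩
  intro h
  exact hp (by simpa using congrArg Subtype.val h)

/-- ★ **`dim X ≤ 1 ⇒ dim prolong X ≤ 1`** (symmetric `X`). [folklore] -/
theorem finrank_prolong_le_one (X : Submodule ℂ (Fin 5 → Fin 5 → ℂ))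
    (hXs : ∀ x ∈ X, ∀ q r : Fin 5, x q r = x r q) (hX : Module.finrank ℂ X ≤ 1) :
    Module.finrank ℂ (prolong X) ≤ 1 := by
  by_cases h0 : X = ⊥
  · subst h0
    rw [prolong_bot, finrank_bot]
    exact zero_le_one
  obtain ⟨p, hp⟩ := exists_finrank_rowIm_pos X h0
  have hrn := finrank_rowKer_add_finrank_rowIm X p
  have hK : rowKer X p = ⊥ := Submodule.finrank_eq_zero.mp (by omega)
  have hstep := finrank_prolong_le_step X p
  rw [hK, prolong_bot, finrank_bot] at hstep
  have hR := finrank_range_slice_le_one X hXs p (by omega)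
  omega

/-- ★ **`dim X ≤ 2 ⇒ dim prolong X ≤ 2`** (symmetric `X`). [folklore] -/
theorem finrank_prolong_le_two (X : Submodule ℂ (Fin 5 → Fin 5 → ℂ))
    (hXs : ∀ x ∈ X, ∀ q r : Fin 5, x q r = x r q) (hX : Module.finrank ℂ X ≤ 2) :
    Module.finrank ℂ (prolong X) ≤ 2 := by
  by_cases h0 : X = ⊥
  · subst h0
    rw [prolong_bot, finrank_bot]
    exact Nat.zero_le _
  obtain ⟨p, hp⟩ := exists_finrank_rowIm_pos X h0
  have hrn := finrank_rowKer_add_finrank_rowIm X p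
  have hstep := finrank_prolong_le_step X p
  have hKs : ∀ x ∈ rowKer X p, ∀ q r : Fin 5, x q r = x r q := fun x hx => hXs x (rowKer_le X p hx)
  have hRX : Module.finrank ℂ (LinearMap.range ((sliceMap p).domRestrict (prolong X))) ≤ Module.finrank ℂ X :=
    Submodule.finrank_mono (range_slice_le X p)
  rcases Nat.lt_or_ge (Module.finrank ℂ (rowIm X p)) 2 with h1 | h2
  · -- `ℓ = 1`: image `≤ 1`, `dim K_p ≤ 1` so `dim prolong K_p ≤ 1`
    have hR := finrank_range_slice_le_one X hXs p (by omega)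
    have hK := finrank_prolong_le_one (rowKer X p) hKs (by omega)
    omega
  · -- `ℓ ≥ 2`: `K_p = ⊥`, image `≤ dim X ≤ 2`
    have hK : rowKer X p = ⊥ := Submodule.finrank_eq_zero.mp (by omega)
    rw [hK, prolong_bot, finrank_bot] at hstep
    omega

/-- ★★ **`dim X ≤ 3 ⇒ dim prolong X ≤ 4`** (symmetric `X`; sharp at `X = Sym² P` for a `2`-plane `P`): the case
`h₂ ≤ 3 ⇒ h₃ ≤ 4` of Macaulay's bound, by the slice argument. [folklore] -/
theorem finrank_prolong_le_four (X : Submodule ℂ (Fin 5 → Fin 5 → ℂ))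
    (hXs : ∀ x ∈ X, ∀ q r : Fin 5, x q r = x r q) (hX : Module.finrank ℂ X ≤ 3) :
    Module.finrank ℂ (prolong X) ≤ 4 := by
  by_cases h0 : X = ⊥
  · subst h0
    rw [prolong_bot, finrank_bot]
    exact Nat.zero_le _
  obtain ⟨p, hp⟩ := exists_finrank_rowIm_pos X h0
  have hrn := finrank_rowKer_add_finrank_rowIm X p
  have hstep := finrank_prolong_le_step X p
  have hKs : ∀ x ∈ rowKer X p, ∀ q r : Fin 5, x q r = x r q := fun x hx => hXs x (rowKer_le X p hx)
  have hRX : Module.finrank ℂ (LinearMap.range ((sliceMap p).domRestrict (prolong X))) ≤ Module.finrank ℂ X :=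
    Submodule.finrank_mono (range_slice_le X p)
  rcases Nat.lt_or_ge (Module.finrank ℂ (rowIm X p)) 2 with h1 | h2
  · -- `ℓ = 1`: image `≤ 1`, `dim K_p ≤ 2` so `dim prolong K_p ≤ 2`
    have hR := finrank_range_slice_le_one X hXs p (by omega)
    have hK := finrank_prolong_le_two (rowKer X p) hKs (by omega)
    omega
  · -- `ℓ ≥ 2`: `dim K_p ≤ 1` so `dim prolong K_p ≤ 1`, image `≤ dim X ≤ 3`
    have hK := finrank_prolong_le_one (rowKer X p) hKs (by omega)
    omega

end LaplaceFiveSeparatedCapture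

end Summit.ValiantsHypothesis.ValiantsHypothesis.Theorems.RigidityForcesSymmetryRankRigidMinimalRepr
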